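import Summits.QuantumFields.BalabanUV.Beta.GAN24.VertexFacePushOfWardLetters
import Summits.QuantumFields.BalabanUV.Beta.GAN24.FaceWWordLetters

/-!
# `BalabanUV.Beta.GAN24.MixedWordZeroOfWardLetters` — binder row G-an2-4 ∕ (CONV-C), TRANSFER-III («slot the chain», the OWNER gan24-p1's `TRANSFER-III-SIZING.v0_7.md` §3(a),
# second option; R-gan24p1-g46-2): **THE TWO MIXED WORDS OF leaf-06 K6c's `W`-WORD VANISH FOR ANY PACKED KERNEL CARRYING THE MULTIPLIER-COLUMN WARD LETTER** — MY Part 48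
# `FaceWWordLetters` §3–§4 RE-CUT OVER A GENERIC KERNEL `X` WITH DISPLAYED LETTERS (DG)(W-M)(TG), and the instance at the COMB-CHART dressed step `X̃′_j := unitK s_f s_m (GcombSh Lc j)`
# of row D1's literal of record (III′) (G-an2-4 CRUX TEAM (2), leaf prover `b2b-balaban-gan24-formalise-leaf-02`, gen 78)

NOT IN PRINT; OUR BOOKKEEPING ([folklore] BY NAME over `VertexFacePushOfWardLetters.hasSum_coordWeight_vertexOfM_slice_of_ward` (this gen), MY Part 48's generic §2 (`biLoc_mixOfK_far`,
`locStencilFM_mono`), an2's `SecondOrderResponse.biLoc_vertexOfM_slice ∕ mixOfK_translate`, leaf-06 K4a `JointPeriodicCellSwap.sum_box_tsum_swap_weight`, Part 45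
`FaceWordsDeepCurrents.abs_tsum_weightPair_le ∕ tsum_weightPair_shiftK ∕ sum_tsum_factor`, leaf-06's `KernelLegCharges.summable_exp_coarse` and, for the instance, an2's (III′) letters
`CombChartWardSockets.colM_GcombSh_ward`, `CombChartStepJets.decays_GcombSh ∕ shiftK_GcombSh`; 0 `def`, 0 cited fact, 0 `def … : Prop`, 0 sorry).
HONEST FRAMING (cell contract, verbatim): «discharging `BetaPertH` makes Bałaban's UV stability UNCONDITIONAL — a real constructive-QFT result; it is NOT the continuum limit and NOT
the Clay problem.»  HONEST DEPENDENCY (verbatim): «continuum YM on T⁴ ⇐ BetaPertH ∧ nine spine estimates (0/9 proved); BetaPertH ⇐ (D1) ∧ (D4) ∧ CAP+tail; G-an2-4 gates asym, D1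
and NE2/3/4.»

WHY.  In the supplier chain of row (C)sym (T6-STEP) the `W`-word of leaf-06 K6c on faces splits into two RESPONSE words (leg-odd, MY Part 48 §1 — generic) and two MIXED words, which
vanish at (E) by Part 48 §3–§4: entrywise under a single-coordinate weight on the multiplier-column bond (§3), and at face level for the direct and the exchanged word (§4).  Those
proofs read the dressed step `X̃ = unitK s_f s_m (coDressKBmAt ρ Lc (KInvStep Lc j))` through three letters only — decay (DG), the multiplier-column Ward law (W-M) (through Part 46's
slice zero) and block translation (TG) (through an2's `mixOfK_translate`).  This file proves them ONCE over the letters, so that the (III′) dressed step `unitK s_f s_m (GcombSh Lc j)`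
(§2) is an instance; (E) is MY Part 48, NOT restated.

WHAT (generic `d`, `Lc ≥ 1`; `X : MKer (d+1) (Fib d)` with (DG) `Decays X CK δ`, `δ > 0`; (W-M) `∀ y ρ w, Σ_μ (colM X Lc μ (y − e_μ) ρ w − colM X Lc μ y ρ w) = 0`; (TG) `∀ t,
shiftK (−(Lc•t)) X = X`; ANY mixed table `M₂` with `LocStencilFM Lc M₂ C₂ δ₂`, bounded weights, any integer leg modulus):
* §1 **`hasSum_coordWeight_mixOfK_snd_of_ward`** (`HasSum (y′ ↦ f(y′_ν)·mixOfK X Lc M₂ μ y ν y′ x z a b) 0`), **`tsum_faceBond_mixWord_eq_zero_of_ward`** (the direct mixed face word,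
  free multiplier bond), **`sum_box_tsum_mixWord_swap_eq_zero_of_ward`** (the exchanged mixed face word, cell on the multiplier bond; `(P, Lc·P)`-covariant `M₂`, `P`-periodic bond
  weights, `Lc·P`-periodic leg weight) — MY Part 48 §3–§4 token for token with `X` for `X̃`.
* §2 THE (III′) INSTANCE `X̃′_j := unitK s_f s_m (GcombSh Lc j)` (ANY units, every `j`; no in-block-root hypothesis): `hasSum_coordWeight_mixOfK_snd_combStep`,
  `tsum_faceBond_mixWord_combStep_eq_zero`, `sum_box_tsum_mixWord_swap_combStep_eq_zero`.
Asserts NO value of any table; discharges NOTHING of (C) ∕ (C)sym ∕ `hstep` ∕ `hSrc` ∕ `hSrcX` ∕ (Q-L) ∕ `(hS, hSall)` ∕ `(hW, hWall)` at (E) or (III′); NEVER «G-an2-4 closed» as (CONV-C);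
NOT D1, NOT `BetaPertH`, NOT continuum, NOT Clay.  2026-08-25; no existing file touched.
-/

noncomputable section

open Finset
open scoped BigOperators
open Literature.MathematicalPhysics.QuantumFieldTheory
open Literature.MathematicalPhysics.QuantumFieldTheory.Balaban1983to89
open Literature.MathematicalPhysics.QuantumFieldTheory.Balaban1983to89.Beta
open B12Sec2to5 (l1 l1_nonneg)
open B6BondElimination (unitVec)
open ExpKernelCalculus (Site MKer Decays BiLoc shiftK exp_mid l1_sub_symm Zl Zl_pos Zl_nonneg summable_exp_shift summable_exp_shift' tsum_exp_shift')
open OneStepResolventKernel (Fib LocStencil biLoc_mono bound_mono wsum)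
open AffineAveraging (box toSite)
open OneStepKernelFamily (colH abs_colH_le vertexOfK)
open SecondOrderResponse (colM vertexOfM dM mixOfK LocStencilFM biLoc_vertexOfM_slice biLoc_wsum_self_far mixOfK_translate)
open Summit.QuantumFields.BalabanUV.Beta.HessKerDressedUnits (unitK decays_unitK)
open Summit.QuantumFields.BalabanUV.Beta.GAN24.JointPeriodicCellSwap (sum_box_tsum_swap_weight)
open Summit.QuantumFields.BalabanUV.Beta.GAN24.FaceWordsDeepCurrents (abs_tsum_weightPair_le tsum_weightPair_shiftK sum_tsum_factor)
open Summit.QuantumFields.BalabanUV.Beta.GAN24.FaceWWordLetters (biLoc_mixOfK_far locStencilFM_mono)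
open Summit.QuantumFields.BalabanUV.Beta.GAN24.ColumnResponseOfWardLetters (colM_ward_unitK shiftK_unitK_of_shiftK)
open Summit.QuantumFields.BalabanUV.Beta.GAN24.VertexFacePushOfWardLetters (hasSum_coordWeight_vertexOfM_slice_of_ward)
open Summit.QuantumFields.BalabanUV.Beta.CombChartStepJets (GcombSh decays_GcombSh shiftK_GcombSh)
open Summit.QuantumFields.BalabanUV.Beta.CombChartWardSockets (colM_GcombSh_ward)

namespace Summit.QuantumFields.BalabanUV.Beta.GAN24.MixedWordZeroOfWardLetters

variable {d : ℕ} {Lc : ℕ} [NeZero Lc]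

/-! ## §1 The mixed words of a kernel with the letters (DG)(W-M)(TG) -/

section Ward

variable {X : MKer (d + 1) (Fib d)} {CK δ : ℝ}

/-- NOT IN PRINT; OUR BOOKKEEPING.  **`HasSum (y′ ↦ f(y′_ν)·mixOfK X Lc M₂ μ y ν y′ x z a b) 0` FROM THE LETTERS (DG)(W-M)** (every bounded `f : ℤ → ℝ`, every field-column bond
`(μ, y)`, every entry): MY Part 48 §3 token for token, the `y′`-fibres being `VertexFacePushOfWardLetters.hasSum_coordWeight_vertexOfM_slice_of_ward`. -/
theorem hasSum_coordWeight_mixOfK_snd_of_ward (hX : Decays X CK δ) (hδ : 0 < δ)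
    (hMw : ∀ (y : Site (d + 1)) (ρ : Fin (d + 1)) (w : Site (d + 1)), ∑ μ, (colM X Lc μ (y - unitVec μ) ρ w - colM X Lc μ y ρ w) = 0)
    {M₂ : Fin (d + 1) → Site (d + 1) → Fin (d + 1) → Site (d + 1) → MKer (d + 1) (Fib d)} {C₂ δ₂ : ℝ} (hM₂ : LocStencilFM Lc M₂ C₂ δ₂) (hδ₂ : 0 < δ₂)
    (μ : Fin (d + 1)) (y : Site (d + 1)) (ν : Fin (d + 1)) (f : ℤ → ℝ) {B : ℝ} (hf : ∀ s, |f s| ≤ B) (x z : Site (d + 1)) (a b : Fib d) :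
    HasSum (fun y' : Site (d + 1) => f (y' ν) * mixOfK X Lc M₂ μ y ν y' x z a b) 0 := by
  classical
  -- common rate
  have hLc : 1 ≤ Lc := Nat.one_le_iff_ne_zero.2 (NeZero.ne Lc)
  have hCK0 : 0 ≤ CK := hX.nonneg (Sum.inl 0)
  have hC₂ : 0 ≤ C₂ := hM₂.nonneg
  set m : ℝ := min δ δ₂ with hm
  have hm0 : 0 < m := lt_min hδ hδ₂
  have hKm : Decays X CK m :=
    OneStepResolventKernel.decays_mono hX hCK0 le_rfl (min_le_left _ _)
  have hM₂m : LocStencilFM Lc M₂ C₂ m := locStencilFM_mono hM₂ hC₂ (min_le_right _ _)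
  have hB : 0 ≤ B := (abs_nonneg _).trans (hf 0)
  -- bounds
  set Cv : ℝ := (d + 1 : ℕ) * (CK * C₂ * Zl (d + 1) (m / 2)) with hCv
  have hCv0 : 0 ≤ Cv := by have := Zl_nonneg (D := d + 1) (half_pos hm0); positivity
  have hV : ∀ (κ : Fin (d + 1)) (u y' : Site (d + 1)),
      |vertexOfM (X) Lc (M₂ κ u) ν y' x z a b|
        ≤ Cv * Real.exp (-(m / 2) * l1 (u - (Lc : ℤ) • y')) := by
    intro κ u y'
    have h := biLoc_vertexOfM_slice (N := Lc) hKm hCK0 hM₂m hm0 κ u ν y' x z a b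
    refine h.trans ?_
    rw [← mul_assoc]
    have h1 : Real.exp (-m * (l1 (x - u) + l1 (z - u))) ≤ 1 := by
      rw [Real.exp_le_one_iff]; nlinarith [l1_nonneg (x - u), l1_nonneg (z - u), hm0.le]
    have h0 : 0 ≤ Cv * Real.exp (-(m / 2) * l1 (u - (Lc : ℤ) • y')) := by positivity
    calc (d + 1 : ℕ) * (CK * C₂ * Zl (d + 1) (m / 2)) * Real.exp (-(m / 2) * l1 (u - (Lc : ℤ) • y')) * Real.exp (-m * (l1 (x - u) + l1 (z - u)))
        ≤ Cv * Real.exp (-(m / 2) * l1 (u - (Lc : ℤ) • y')) * 1 := mul_le_mul_of_nonneg_left h1 h0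
      _ = _ := mul_one _
  have hH : ∀ (κ : Fin (d + 1)) (u : Site (d + 1)),
      |colH (X) Lc μ y κ u| ≤ CK * Real.exp (-(m / 2) * l1 (u - (Lc : ℤ) • y)) :=
    fun κ u => bound_mono (abs_colH_le (N := Lc) hKm μ y κ u) hCK0 le_rfl (by linarith) (l1_nonneg _)
  -- the double family over `(y′, u)` per field direction `κ`
  have hF : ∀ κ : Fin (d + 1), Summable fun q : Site (d + 1) × Site (d + 1) =>
      f (q.1 ν) * (colH (X) Lc μ y κ q.2 *
        vertexOfM (X) Lc (M₂ κ q.2) ν q.1 x z a b) := by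
    intro κ
    have hg : Summable fun q : Site (d + 1) × Site (d + 1) =>
        Real.exp (-(m / 2 / 2) * l1 ((Lc : ℤ) • y - (Lc : ℤ) • q.1)) * Real.exp (-(m / 2 / 2) * l1 (q.2 - (Lc : ℤ) • y)) := by
      have h1 : Summable fun y' : Site (d + 1) => Real.exp (-(m / 2 / 2) * l1 ((Lc : ℤ) • y - (Lc : ℤ) • y')) :=
        (KernelLegCharges.summable_exp_coarse hLc (by positivity : 0 < m / 2 / 2) ((Lc : ℤ) • y)).congr fun y' => by rw [l1_sub_symm]
      exact h1.mul_of_nonneg (summable_exp_shift' (by positivity) _) (fun _ => (Real.exp_pos _).le) (fun _ => (Real.exp_pos _).le)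
    refine Summable.of_norm_bounded (hg.mul_left (B * (CK * Cv))) (fun q => ?_)
    rw [Real.norm_eq_abs, abs_mul, abs_mul]
    have e := exp_mid (show (0 : ℝ) ≤ m / 2 by positivity) q.2 ((Lc : ℤ) • y) ((Lc : ℤ) • q.1)
    have h2 : |colH (X) Lc μ y κ q.2| *
        |vertexOfM (X) Lc (M₂ κ q.2) ν q.1 x z a b|
        ≤ CK * Cv * Real.exp (-(m / 2) * (l1 (q.2 - (Lc : ℤ) • y) + l1 (q.2 - (Lc : ℤ) • q.1))) := by
      calc _ ≤ (CK * Real.exp (-(m / 2) * l1 (q.2 - (Lc : ℤ) • y))) * (Cv * Real.exp (-(m / 2) * l1 (q.2 - (Lc : ℤ) • q.1))) :=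
            mul_le_mul (hH κ q.2) (hV κ q.2 q.1) (abs_nonneg _) (by positivity)
        _ = CK * Cv * Real.exp (-(m / 2) * (l1 (q.2 - (Lc : ℤ) • y) + l1 (q.2 - (Lc : ℤ) • q.1))) := by rw [mul_add, Real.exp_add]; ring
    calc |f (q.1 ν)| * (|colH X Lc μ y κ q.2| * |vertexOfM X Lc (M₂ κ q.2) ν q.1 x z a b|)
        ≤ B * (CK * Cv * Real.exp (-(m / 2) * (l1 (q.2 - (Lc : ℤ) • y) + l1 (q.2 - (Lc : ℤ) • q.1)))) :=
          mul_le_mul (hf _) h2 (mul_nonneg (abs_nonneg _) (abs_nonneg _)) hB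
      _ ≤ B * (CK * Cv * (Real.exp (-(m / 2 / 2) * l1 ((Lc : ℤ) • y - (Lc : ℤ) • q.1)) * Real.exp (-(m / 2 / 2) * l1 (q.2 - (Lc : ℤ) • y)))) := by
          gcongr
      _ = B * (CK * Cv) * (Real.exp (-(m / 2 / 2) * l1 ((Lc : ℤ) • y - (Lc : ℤ) • q.1)) * Real.exp (-(m / 2 / 2) * l1 (q.2 - (Lc : ℤ) • y))) := by ring
  -- the `y′`-fibres vanish (Part 46), the `u`-fibres are summable: total = 0 either way
  have hfib : ∀ (κ : Fin (d + 1)) (u : Site (d + 1)), HasSum (fun y' : Site (d + 1) =>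
      f (y' ν) * (colH (X) Lc μ y κ u *
        vertexOfM (X) Lc (M₂ κ u) ν y' x z a b)) 0 := by
    intro κ u
    have h := (hasSum_coordWeight_vertexOfM_slice_of_ward hX hδ hMw ν f hf hM₂ hδ₂ κ u x z a b).mul_left
      (colH (X) Lc μ y κ u)
    rw [mul_zero] at h
    exact h.congr_fun fun y' => by ring
  have hκ : ∀ κ : Fin (d + 1), HasSum (fun y' : Site (d + 1) => ∑' u : Site (d + 1),
      f (y' ν) * (colH (X) Lc μ y κ u *
        vertexOfM (X) Lc (M₂ κ u) ν y' x z a b)) 0 := by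
    intro κ
    -- total over the product: summing `y′` first fibrewise gives 0
    have hswap : Summable fun q : Site (d + 1) × Site (d + 1) =>
        f (q.2 ν) * (colH (X) Lc μ y κ q.1 *
          vertexOfM (X) Lc (M₂ κ q.1) ν q.2 x z a b) := (hF κ).prod_symm
    have htot : HasSum (fun q : Site (d + 1) × Site (d + 1) =>
        f (q.2 ν) * (colH (X) Lc μ y κ q.1 *
          vertexOfM (X) Lc (M₂ κ q.1) ν q.2 x z a b)) 0 := by
      have h := hswap.hasSum
      have hval : ∑' q : Site (d + 1) × Site (d + 1), f (q.2 ν) * (colH (X) Lc μ y κ q.1 *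
          vertexOfM (X) Lc (M₂ κ q.1) ν q.2 x z a b) = 0 := by
        rw [hswap.tsum_prod]
        simp_rw [(hfib κ _).tsum_eq]
        exact tsum_zero
      rwa [hval] at h
    -- summing `u` first: the fibrewise sums in the other order
    have h2 := (hF κ).hasSum
    have hval2 : ∑' q : Site (d + 1) × Site (d + 1), f (q.1 ν) * (colH (X) Lc μ y κ q.2 *
        vertexOfM (X) Lc (M₂ κ q.2) ν q.1 x z a b) = 0 := by
      rw [← (Equiv.prodComm (Site (d + 1)) (Site (d + 1))).tsum_eq]
      exact htot.tsum_eq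
    rw [hval2] at h2
    exact h2.prod_fiberwise fun y' => ((hF κ).prod_factor y').hasSum
  -- assemble over `κ` and unfold `mixOfK`
  have hsum := hasSum_sum (s := (Finset.univ : Finset (Fin (d + 1)))) fun κ _ => hκ κ
  rw [Finset.sum_const_zero] at hsum
  refine hsum.congr_fun fun y' => ?_
  simp only [SecondOrderResponse.mixOfK, OneStepKernelFamily.vertexOfK, OneStepResolventKernel.wsum]
  rw [Finset.mul_sum]
  refine Finset.sum_congr rfl fun κ _ => ?_
  rw [← tsum_mul_left]

/-- NOT IN PRINT; OUR BOOKKEEPING.  **THE DIRECT MIXED FACE WORD VANISHES, FROM THE LETTERS (DG)(W-M)** (field column at any bond `(μ, y)`, multiplier column summed over its bond `u′` against a bounded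
single-coordinate weight `f(u′_ν)`, legs against a bounded pair weight `m`): `Σ'_{u′} f(u′_ν)·Σ'_{(y₁,w)} m·mixOfK X̃ Lc M₂ μ y ν u′ (y₁,w)(a,b) = 0` (one dominated exchange
over `(u′, (y₁,w))` by §2, then §3 fibrewise). -/
theorem tsum_faceBond_mixWord_eq_zero_of_ward (hX : Decays X CK δ) (hδ : 0 < δ)
    (hMw : ∀ (y : Site (d + 1)) (ρ : Fin (d + 1)) (w : Site (d + 1)), ∑ μ, (colM X Lc μ (y - unitVec μ) ρ w - colM X Lc μ y ρ w) = 0)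
    {M₂ : Fin (d + 1) → Site (d + 1) → Fin (d + 1) → Site (d + 1) → MKer (d + 1) (Fib d)} {C₂ δ₂ : ℝ} (hM₂ : LocStencilFM Lc M₂ C₂ δ₂) (hδ₂ : 0 < δ₂)
    (μ : Fin (d + 1)) (y : Site (d + 1)) (ν : Fin (d + 1)) (f : ℤ → ℝ) {B : ℝ} (hf : ∀ s, |f s| ≤ B)
    (m : Site (d + 1) × Site (d + 1) → ℝ) (hm : ∀ yw, |m yw| ≤ 1) (a b : Fib d) :
    ∑' u' : Site (d + 1), f (u' ν) * ∑' yw : Site (d + 1) × Site (d + 1), m yw *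
        mixOfK X Lc M₂ μ y ν u' yw.1 yw.2 a b = 0 := by
  classical
  have hLc : 1 ≤ Lc := Nat.one_le_iff_ne_zero.2 (NeZero.ne Lc)
  have hCK0 : 0 ≤ CK := hX.nonneg (Sum.inl 0)
  have hC₂ : 0 ≤ C₂ := hM₂.nonneg
  set m₀ : ℝ := min δ δ₂ with hm₀
  have hm0 : 0 < m₀ := lt_min hδ hδ₂
  have hKm : Decays X CK m₀ :=
    OneStepResolventKernel.decays_mono hX hCK0 le_rfl (min_le_left δ δ₂)
  have hM₂m : LocStencilFM Lc M₂ C₂ m₀ := locStencilFM_mono hM₂ hC₂ (min_le_right _ _)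
  have hB : 0 ≤ B := (abs_nonneg _).trans (hf 0)
  have hW := fun u' => biLoc_mixOfK_far (N := Lc) hKm hCK0 hM₂m hm0 μ y ν u'
  set cf : ℝ := (d + 1 : ℕ) * (CK * ((d + 1 : ℕ) * (CK * C₂ * Zl (d + 1) (m₀ / 2))) *
    Zl (d + 1) (m₀ / 2 / 4)) with hcf
  have hm8 : 0 < m₀ / 2 / 4 := by positivity
  -- the family over `(u′, (y₁, w))`
  have hF : Summable fun s : Site (d + 1) × (Site (d + 1) × Site (d + 1)) =>
      f (s.1 ν) * (m s.2 * mixOfK X Lc M₂ μ y ν s.1 s.2.1 s.2.2 a b) := by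
    have hg : Summable fun u' : Site (d + 1) => Real.exp (-(m₀ / 2 / 4) * l1 ((Lc : ℤ) • y - (Lc : ℤ) • u')) :=
      (KernelLegCharges.summable_exp_coarse hLc hm8 ((Lc : ℤ) • y)).congr fun u' => by rw [l1_sub_symm]
    have hh : Summable fun yw : Site (d + 1) × Site (d + 1) =>
        Real.exp (-(m₀ / 2 / 4) * l1 (yw.1 - (Lc : ℤ) • y)) * Real.exp (-(m₀ / 2 / 4) * l1 (yw.2 - (Lc : ℤ) • y)) :=
      (summable_exp_shift' hm8 _).mul_of_nonneg (summable_exp_shift' hm8 _) (fun _ => (Real.exp_pos _).le) (fun _ => (Real.exp_pos _).le)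
    have hprod := Summable.mul_of_nonneg hg hh (fun _ => (Real.exp_pos _).le) (fun _ => mul_nonneg (Real.exp_pos _).le (Real.exp_pos _).le)
    refine Summable.of_norm_bounded (hprod.mul_left (B * cf)) (fun s => ?_)
    rw [Real.norm_eq_abs, abs_mul, abs_mul]
    have h : |mixOfK X Lc M₂ μ y ν s.1 s.2.1 s.2.2 a b|
        ≤ cf * Real.exp (-(m₀ / 2 / 4) * l1 ((Lc : ℤ) • y - (Lc : ℤ) • s.1)) * Real.exp (-(m₀ / 2 / 4) * (l1 (s.2.1 - (Lc : ℤ) • y) + l1 (s.2.2 - (Lc : ℤ) • y))) :=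
      (hW s.1 s.2.1 s.2.2 a b).trans (le_of_eq (by ring))
    calc |f (s.1 ν)| * (|m s.2| * |mixOfK X Lc M₂ μ y ν s.1 s.2.1 s.2.2 a b|)
        ≤ B * (1 * (cf * Real.exp (-(m₀ / 2 / 4) * l1 ((Lc : ℤ) • y - (Lc : ℤ) • s.1)) * Real.exp (-(m₀ / 2 / 4) * (l1 (s.2.1 - (Lc : ℤ) • y) + l1 (s.2.2 - (Lc : ℤ) • y))))) :=
          mul_le_mul (hf _) (mul_le_mul (hm _) h (abs_nonneg _) zero_le_one) (mul_nonneg (abs_nonneg _) (abs_nonneg _)) hB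
      _ = B * cf * (Real.exp (-(m₀ / 2 / 4) * l1 ((Lc : ℤ) • y - (Lc : ℤ) • s.1)) *
            (Real.exp (-(m₀ / 2 / 4) * l1 (s.2.1 - (Lc : ℤ) • y)) * Real.exp (-(m₀ / 2 / 4) * l1 (s.2.2 - (Lc : ℤ) • y)))) := by
          rw [one_mul, mul_add, Real.exp_add]; ring
  have hF' : Summable (Function.uncurry fun (u' : Site (d + 1)) (yw : Site (d + 1) × Site (d + 1)) =>
      f (u' ν) * (m yw * mixOfK X Lc M₂ μ y ν u' yw.1 yw.2 a b)) := hF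
  rw [show (∑' u' : Site (d + 1), f (u' ν) * ∑' yw : Site (d + 1) × Site (d + 1), m yw *
        mixOfK X Lc M₂ μ y ν u' yw.1 yw.2 a b)
      = ∑' u' : Site (d + 1), ∑' yw : Site (d + 1) × Site (d + 1), f (u' ν) * (m yw *
        mixOfK X Lc M₂ μ y ν u' yw.1 yw.2 a b)
      from tsum_congr fun u' => tsum_mul_left.symm, ← hF'.tsum_comm]
  have hin : ∀ yw : Site (d + 1) × Site (d + 1), ∑' u' : Site (d + 1), f (u' ν) * (m yw *
      mixOfK X Lc M₂ μ y ν u' yw.1 yw.2 a b) = 0 := by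
    intro yw
    have h := (hasSum_coordWeight_mixOfK_snd_of_ward hX hδ hMw hM₂ hδ₂ μ y ν f hf yw.1 yw.2 a b).mul_left (m yw)
    rw [mul_zero] at h
    rw [← h.tsum_eq]
    exact tsum_congr fun u' => by ring
  simp_rw [hin]
  exact tsum_zero

/-- NOT IN PRINT; OUR BOOKKEEPING.  **THE EXCHANGED MIXED FACE WORD VANISHES, FROM THE LETTERS (DG)(W-M)(TG)** — its multiplier column sits at the CELL bond `(μ, r′)`, `r′ ∈ box P`: move the cell onto the
free bond `u′` (leaf-06 K4a `sum_box_tsum_swap_weight` at periods `(P, P)`; joint covariance by an2's `mixOfK_translate` from (TG) and `M₂` jointly `Lc`-covariant; the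
`Lc·P`-periodicity of the leg weight), then every cell term is the direct word of `tsum_faceBond_mixWord_eq_zero_of_ward` with the two columns' roles exchanged:
`Σ_{r′∈box P} Σ'_{u′} fμ(r′_μ)·fν(u′_ν)·Σ'_{(y₁,w)} m·mixOfK X Lc M₂ ν u′ μ r′ (y₁,w)(a,b) = 0`. -/
theorem sum_box_tsum_mixWord_swap_eq_zero_of_ward (hX : Decays X CK δ) (hδ : 0 < δ)
    (hMw : ∀ (y : Site (d + 1)) (ρ : Fin (d + 1)) (w : Site (d + 1)), ∑ μ, (colM X Lc μ (y - unitVec μ) ρ w - colM X Lc μ y ρ w) = 0)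
    (hXt : ∀ t : Site (d + 1), shiftK (-((Lc : ℤ) • t)) X = X) {P : ℕ} [NeZero P]
    {M₂ : Fin (d + 1) → Site (d + 1) → Fin (d + 1) → Site (d + 1) → MKer (d + 1) (Fib d)} {C₂ δ₂ : ℝ} (hM₂ : LocStencilFM Lc M₂ C₂ δ₂) (hδ₂ : 0 < δ₂)
    (hM₂t : ∀ (κ : Fin (d + 1)) (u : Site (d + 1)) (ρ : Fin (d + 1)) (w t : Site (d + 1)), M₂ κ (u + (Lc : ℤ) • t) ρ (w + t) = shiftK (-((Lc : ℤ) • t)) (M₂ κ u ρ w))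
    (μ ν : Fin (d + 1)) (fμ fν : ℤ → ℝ) {Bμ Bν : ℝ} (hfμ : ∀ s, |fμ s| ≤ Bμ) (hfν : ∀ s, |fν s| ≤ Bν)
    (hfμP : ∀ (u s : Site (d + 1)), fμ ((u + (P : ℤ) • s) μ) = fμ (u μ)) (hfνP : ∀ (u s : Site (d + 1)), fν ((u + (P : ℤ) • s) ν) = fν (u ν))
    (m : Site (d + 1) × Site (d + 1) → ℝ) (hm : ∀ yw, |m yw| ≤ 1)
    (hmN : ∀ (y₁ w₀ s : Site (d + 1)), m (y₁ + (Lc : ℤ) • ((P : ℤ) • s), w₀ + (Lc : ℤ) • ((P : ℤ) • s)) = m (y₁, w₀)) (a b : Fib d) :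
    ∑ r' ∈ box (d + 1) P, ∑' u' : Site (d + 1), fμ (toSite r' μ) * fν (u' ν) * ∑' yw : Site (d + 1) × Site (d + 1), m yw *
        mixOfK X Lc M₂ ν u' μ (toSite r') yw.1 yw.2 a b = 0 := by
  classical
  have hLc : 1 ≤ Lc := Nat.one_le_iff_ne_zero.2 (NeZero.ne Lc)
  have hCK0 : 0 ≤ CK := hX.nonneg (Sum.inl 0)
  have hC₂ : 0 ≤ C₂ := hM₂.nonneg
  set m₀ : ℝ := min δ δ₂ with hm₀
  have hm0 : 0 < m₀ := lt_min hδ hδ₂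
  have hKm : Decays X CK m₀ :=
    OneStepResolventKernel.decays_mono hX hCK0 le_rfl (min_le_left δ δ₂)
  have hM₂m : LocStencilFM Lc M₂ C₂ m₀ := locStencilFM_mono hM₂ hC₂ (min_le_right _ _)
  have hBμ : 0 ≤ Bμ := (abs_nonneg _).trans (hfμ 0)
  have hBν : 0 ≤ Bν := (abs_nonneg _).trans (hfν 0)
  have hm8 : 0 < m₀ / 2 / 4 := by positivity
  -- the word as a bi-sequence of its two bonds: first slot = the field-column bond `u′`, second = the multiplier-column bond `r′`
  set G : Site (d + 1) → Site (d + 1) → ℝ := fun r' u' => ∑' yw : Site (d + 1) × Site (d + 1), m yw *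
    mixOfK X Lc M₂ ν u' μ r' yw.1 yw.2 a b with hGdef
  have hW := fun u' r' => biLoc_mixOfK_far (N := Lc) hKm hCK0 hM₂m hm0 ν u' μ r'
  set cf : ℝ := (d + 1 : ℕ) * (CK * ((d + 1 : ℕ) * (CK * C₂ * Zl (d + 1) (m₀ / 2))) *
    Zl (d + 1) (m₀ / 2 / 4)) with hcf
  have hGb : ∀ r' u', |G r' u'| ≤ cf * (Zl (d + 1) (m₀ / 2 / 4) * Zl (d + 1) (m₀ / 2 / 4)) * Real.exp (-(m₀ / 2 / 4) * l1 ((Lc : ℤ) • u' - (Lc : ℤ) • r')) := by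
    intro r' u'
    have h := abs_tsum_weightPair_le (hW u' r') hm8 m hm a b
    exact h.trans (le_of_eq (by ring))
  have hmv : ∀ (s y₁ w₀ : Site (d + 1)), m (y₁ + -((Lc : ℤ) • ((P : ℤ) • s)), w₀ + -((Lc : ℤ) • ((P : ℤ) • s))) = m (y₁, w₀) := by
    intro s y₁ w₀
    have h := hmN y₁ w₀ (-s)
    rwa [smul_neg, smul_neg] at h
  rw [sum_tsum_factor]
  rw [sum_box_tsum_swap_weight (P := P) (Q := P) G (fun u => fμ (u μ)) (fun u => fν (u ν))
      (fun r' u' s => by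
        show (∑' yw : Site (d + 1) × Site (d + 1), m yw * mixOfK X Lc M₂ ν (u' + (P : ℤ) • s) μ (r' + (P : ℤ) • s) yw.1 yw.2 a b) = _
        rw [mixOfK_translate (N := Lc) hXt hM₂t ν u' μ r' ((P : ℤ) • s), tsum_weightPair_shiftK m _ (hmv s)])
      hfμP hfνP
      (fun r' => Summable.of_norm_bounded ((KernelLegCharges.summable_exp_coarse hLc hm8 ((Lc : ℤ) • r')).mul_left
          (Bν * (cf * (Zl (d + 1) (m₀ / 2 / 4) * Zl (d + 1) (m₀ / 2 / 4))))) (fun u' => by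
        rw [Real.norm_eq_abs, abs_mul]
        calc |fν (u' ν)| * |G r' u'| ≤ Bν * (cf * (Zl (d + 1) (m₀ / 2 / 4) * Zl (d + 1) (m₀ / 2 / 4)) * Real.exp (-(m₀ / 2 / 4) * l1 ((Lc : ℤ) • u' - (Lc : ℤ) • r'))) :=
              mul_le_mul (hfν _) (hGb r' u') (abs_nonneg _) hBν
          _ = _ := by ring))
      (fun u' => Summable.of_norm_bounded (((KernelLegCharges.summable_exp_coarse hLc hm8 ((Lc : ℤ) • u')).congr fun r' => by rw [l1_sub_symm]).mul_left
          (Bμ * (cf * (Zl (d + 1) (m₀ / 2 / 4) * Zl (d + 1) (m₀ / 2 / 4))))) (fun r' => by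
        rw [Real.norm_eq_abs, abs_mul]
        calc |fμ (r' μ)| * |G r' u'| ≤ Bμ * (cf * (Zl (d + 1) (m₀ / 2 / 4) * Zl (d + 1) (m₀ / 2 / 4)) * Real.exp (-(m₀ / 2 / 4) * l1 ((Lc : ℤ) • u' - (Lc : ℤ) • r'))) :=
              mul_le_mul (hfμ _) (hGb r' u') (abs_nonneg _) hBμ
          _ = _ := by ring))]
  refine Finset.sum_eq_zero fun u' _ => ?_
  rw [tsum_faceBond_mixWord_eq_zero_of_ward hX hδ hMw hM₂ hδ₂ ν (toSite u') μ fμ hfμ m hm a b, mul_zero]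

end Ward

/-! ## §2 The (III′) instance `X̃′_j = unitK s_f s_m (GcombSh Lc j)` -/

section CombStep

variable (Lc)

/-- NOT IN PRINT; OUR BOOKKEEPING.  **(III′) — THE MIXED BI-VERTEX OF THE COMB-CHART DRESSED STEP DIES ENTRYWISE UNDER A SINGLE-COORDINATE WEIGHT ON ITS MULTIPLIER-COLUMN BOND**
(every `j`, ANY units, any `LocStencilFM` table, bounded `f`): `HasSum (y′ ↦ f(y′_ν)·mixOfK X̃′_j Lc M₂ μ y ν y′ x z a b) 0` — the (III′) twin of MY Part 48 `hasSum_coordWeight_mixOfK_snd`. -/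
theorem hasSum_coordWeight_mixOfK_snd_combStep (sf sm : ℝ) (j : ℕ)
    {M₂ : Fin (d + 1) → Site (d + 1) → Fin (d + 1) → Site (d + 1) → MKer (d + 1) (Fib d)} {C₂ δ₂ : ℝ} (hM₂ : LocStencilFM Lc M₂ C₂ δ₂) (hδ₂ : 0 < δ₂)
    (μ : Fin (d + 1)) (y : Site (d + 1)) (ν : Fin (d + 1)) (f : ℤ → ℝ) {B : ℝ} (hf : ∀ s, |f s| ≤ B) (x z : Site (d + 1)) (a b : Fib d) :
    HasSum (fun y' : Site (d + 1) => f (y' ν) * mixOfK (unitK sf sm (GcombSh (d := d) Lc j)) Lc M₂ μ y ν y' x z a b) 0 := by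
  obtain ⟨δ, C, hδ, _, hK⟩ := decays_GcombSh (d := d) Lc j
  exact hasSum_coordWeight_mixOfK_snd_of_ward (decays_unitK hK) hδ
    (colM_ward_unitK (fun y ρ w => colM_GcombSh_ward (d := d) (Lc := Lc) j y ρ w) sf sm) hM₂ hδ₂ μ y ν f hf x z a b

/-- NOT IN PRINT; OUR BOOKKEEPING.  **(III′) — THE DIRECT MIXED FACE WORD OF THE COMB-CHART DRESSED STEP VANISHES** — the (III′) twin of MY Part 48 `tsum_faceBond_mixWord_eq_zero`. -/
theorem tsum_faceBond_mixWord_combStep_eq_zero (sf sm : ℝ) (j : ℕ)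
    {M₂ : Fin (d + 1) → Site (d + 1) → Fin (d + 1) → Site (d + 1) → MKer (d + 1) (Fib d)} {C₂ δ₂ : ℝ} (hM₂ : LocStencilFM Lc M₂ C₂ δ₂) (hδ₂ : 0 < δ₂)
    (μ : Fin (d + 1)) (y : Site (d + 1)) (ν : Fin (d + 1)) (f : ℤ → ℝ) {B : ℝ} (hf : ∀ s, |f s| ≤ B)
    (m : Site (d + 1) × Site (d + 1) → ℝ) (hm : ∀ yw, |m yw| ≤ 1) (a b : Fib d) :
    ∑' u' : Site (d + 1), f (u' ν) * ∑' yw : Site (d + 1) × Site (d + 1), m yw *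
        mixOfK (unitK sf sm (GcombSh (d := d) Lc j)) Lc M₂ μ y ν u' yw.1 yw.2 a b = 0 := by
  obtain ⟨δ, C, hδ, _, hK⟩ := decays_GcombSh (d := d) Lc j
  exact tsum_faceBond_mixWord_eq_zero_of_ward (decays_unitK hK) hδ
    (colM_ward_unitK (fun y ρ w => colM_GcombSh_ward (d := d) (Lc := Lc) j y ρ w) sf sm) hM₂ hδ₂ μ y ν f hf m hm a b

/-- NOT IN PRINT; OUR BOOKKEEPING.  **(III′) — THE EXCHANGED MIXED FACE WORD OF THE COMB-CHART DRESSED STEP VANISHES** (`(P, Lc·P)`-covariant `M₂`, `P`-periodic bond weights, `Lc·P`-periodic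
leg weight) — the (III′) twin of MY Part 48 `sum_box_tsum_mixWord_swap_eq_zero` (`shiftK_GcombSh` for (TG)). -/
theorem sum_box_tsum_mixWord_swap_combStep_eq_zero (sf sm : ℝ) (j : ℕ) {P : ℕ} [NeZero P]
    {M₂ : Fin (d + 1) → Site (d + 1) → Fin (d + 1) → Site (d + 1) → MKer (d + 1) (Fib d)} {C₂ δ₂ : ℝ} (hM₂ : LocStencilFM Lc M₂ C₂ δ₂) (hδ₂ : 0 < δ₂)
    (hM₂t : ∀ (κ : Fin (d + 1)) (u : Site (d + 1)) (ρ : Fin (d + 1)) (w t : Site (d + 1)), M₂ κ (u + (Lc : ℤ) • t) ρ (w + t) = shiftK (-((Lc : ℤ) • t)) (M₂ κ u ρ w))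
    (μ ν : Fin (d + 1)) (fμ fν : ℤ → ℝ) {Bμ Bν : ℝ} (hfμ : ∀ s, |fμ s| ≤ Bμ) (hfν : ∀ s, |fν s| ≤ Bν)
    (hfμP : ∀ (u s : Site (d + 1)), fμ ((u + (P : ℤ) • s) μ) = fμ (u μ)) (hfνP : ∀ (u s : Site (d + 1)), fν ((u + (P : ℤ) • s) ν) = fν (u ν))
    (m : Site (d + 1) × Site (d + 1) → ℝ) (hm : ∀ yw, |m yw| ≤ 1)
    (hmN : ∀ (y₁ w₀ s : Site (d + 1)), m (y₁ + (Lc : ℤ) • ((P : ℤ) • s), w₀ + (Lc : ℤ) • ((P : ℤ) • s)) = m (y₁, w₀)) (a b : Fib d) :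
    ∑ r' ∈ box (d + 1) P, ∑' u' : Site (d + 1), fμ (toSite r' μ) * fν (u' ν) * ∑' yw : Site (d + 1) × Site (d + 1), m yw *
        mixOfK (unitK sf sm (GcombSh (d := d) Lc j)) Lc M₂ ν u' μ (toSite r') yw.1 yw.2 a b = 0 := by
  obtain ⟨δ, C, hδ, _, hK⟩ := decays_GcombSh (d := d) Lc j
  exact sum_box_tsum_mixWord_swap_eq_zero_of_ward (decays_unitK hK) hδ
    (colM_ward_unitK (fun y ρ w => colM_GcombSh_ward (d := d) (Lc := Lc) j y ρ w) sf sm)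
    (shiftK_unitK_of_shiftK (fun t => shiftK_GcombSh (d := d) Lc j t) sf sm) hM₂ hδ₂ hM₂t μ ν fμ fν hfμ hfν hfμP hfνP m hm hmN a b

end CombStep

end Summit.QuantumFields.BalabanUV.Beta.GAN24.MixedWordZeroOfWardLetters

end
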